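import Literature.Algebra.Lie.LefschetzStringInvariantForm
import Literature.GroupTheory.FiniteAbelian.AlternatingPairing
import HarnessLib

/-!
# Parity constraints from a non-degenerate invariant form: multiplicities of `V(k)` are even when `ε(-1)^k = -1` (Looijenga–Lunts 1997, §1 (1.16))

Topic `Literature/Algebra/Lie` (namespace `Literature.Algebra.Lie`).  Lane `lit-hodgefound` (Track 2 foundations
library), skeleton seat `lit-hodgefound-skel-1` (generation 43), row **A1-125** of
`run/shared/lean/pub/lit-hodgefound/SKELETON.md`: the "ONLY IF" halves of the parity sentences of Looijenga–Lunts
(1.16) — a finite-dimensional `𝔰𝔩(2)`-representation "admits a nondegenerate invariant skew-symmetric form if and only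
if all multiplicities are even" (even parity) and "the other way around" (odd parity) — in the vocabulary of the series:
for `(M, h)` `ℤ`-graded with a Lefschetz operator `a` (A1-88 `HasLefschetzProperty`), the MULTIPLICITY of `V(k)` in
`M` is `dim P_{-k}`, `P_{-k} = Ker(a^{k+1}) ∩ M_{-k}` the primitive subspace (A1-88 `primitiveSpace`); if `M` carries a
NON-DEGENERATE invariant form `φ` with `φᵀ = εφ` then `dim P_{-k}` is EVEN whenever `ε(-1)^k = -1`, because the
induced form `β_k(p, q) = φ(p, aᵏq)` on `P_{-k}` is non-degenerate and alternating.  THEOREMS ONLY over an arbitrary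
field of characteristic `0`; no definition, no named fact, no `sorry` (D-0026 net debt `0`).  The even-dimension
lemma for non-degenerate alternating forms is the tree's
`Literature.GroupTheory.FiniteAbelian.even_finrank_of_isAlt_of_nondegenerate` (REUSED, not restated).

## Source, VERBATIM

E. Looijenga, V. A. Lunts, *A Lie algebra attached to a projective variety*, Invent. Math. **129** (1997) 361–412,
§1 (1.16) (held TeX text `paper:arxiv-alg-geom_9604014`, p0008 L77–L83):

> "Let us recall that the `𝔰𝔩(2)`-invariant bilinear forms on `V(k)` are generated by a nonzero `(-)^k`-symmetric
> form. So an finite dimensional `𝔰𝔩(2)`-representation of even parity always admits a nondegenerate invariant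
> symmetric form, whereas it admits a nondegenerate invariant skew-symmetric form if and only if all multiplicities
> are even. In the case of odd parity it is just the other way around."

(The first sentence is A1-123 `LefschetzStringInvariantForm.lean`; "parity": p0008 L76–L77 "The degrees that occur all
have the same parity; we refer to this as the parity of `V`"; "multiplicities" = the multiplicities of the `V(k)` in
`V`, i.e. `dim P_{-k}`, (1.15) "`P_{-k}(M) ≅ Hom_𝔤(V(k), M)`".)

## Rendering (dictionary)

* "`𝔰𝔩(2)`-representation `V`" with its grading: `(M, h)` with `IsZGrading h` and a Lefschetz operator `a`
  (`HasLefschetzProperty h a`; by A1-88 (1.1) this is the same as an `𝔰𝔩₂`-triple `(a, h, f)`), finite-dimensional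
  over a field `K` of characteristic `0`.
* "multiplicity of `V(k)`": `finrank K (primitiveSpace h a k)` (`P_{-k}`; each non-zero primitive vector of degree `-k`
  spans a copy of `V(k)`, A1-123/A1-124).
* "nondegenerate invariant symmetric (resp. skew-symmetric) form": `φ : LinearMap.BilinForm K M`, `φ.Nondegenerate`,
  `φ.IsSkewAdjoint h`, `φ.IsSkewAdjoint a`, and `φ.IsSymm` (resp. `LinearMap.flip φ = -φ`).

## Contents (all proved)

* §1 `apply_pow_succ_eq_zero_of_mem_primitiveSpace` (`φ(p, a^{k+1} w) = 0` for `p ∈ P_{-k}`),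
  **`exists_primitive_apply_pow_ne_zero`** (for `φ` left-separating and `0 ≠ p ∈ P_{-k}` there is `q ∈ P_{-k}` with
  `φ(p, aᵏq) ≠ 0` — Lefschetz surjectivity `aᵏ : M_{-k} → M_k` and the primitive decomposition
  `M_{-k} = P_{-k} + a M_{-k-2}` of A1-88).
* §2 the induced form `β_k = φ(·, aᵏ·)` on `P_{-k}` (written inline as `φ.compl₁₂ P.subtype (aᵏ ∘ P.subtype)`, no
  definition): `primitiveForm_apply_swap` (`β_k(q, p) = ε(-1)^k β_k(p, q)` when `φᵀ = εφ`),
  `isAlt_primitiveForm` (alternating when `ε(-1)^k = -1`), `nondegenerate_primitiveForm`,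
  **`even_finrank_primitiveSpace`** (`dim P_{-k}` even when `φ` is non-degenerate, invariant, `φᵀ = εφ`,
  `ε(-1)^k = -1`), and the two printed cases **`even_finrank_primitiveSpace_of_isSymm`** (`φ` symmetric, `k` odd) and
  **`even_finrank_primitiveSpace_of_flip_eq_neg`** (`φ` skew, `k` even).

## SCOPE

(a) Only the "only if" directions are formalised; the "if"/"always admits" directions (constructing a non-degenerate
invariant symmetric or skew form from forms on the `P_{-k}`) are not.  (b) Nothing here concerns complex tori or the
Hodge conjecture.

## References

* [LooijengaLunts1997] E. Looijenga, V. A. Lunts, *A Lie algebra attached to a projective variety*, Invent. Math. 129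
  (1997) 361–412; arXiv:alg-geom/9604014. §1 (1.16), p. 8 L77–L83 of the held TeX text; (1.15) p. 8; (1.1) p. 4.
-/

namespace Literature.Algebra.Lie

open Module Function Set
open LinearMap (BilinForm)
open HasLefschetzProperty (primitiveSpace mem_primitiveSpace_iff)

-- The commutator Lie ring of `𝔤𝔩(M) = Module.End K M`: Mathlib's reducible NON-instance, enabled file-locally
-- exactly as in `LefschetzModule.lean`.
attribute [local instance 100] LieRing.ofAssociativeRing

/-! ### §1 Non-degeneracy descends to the primitive subspaces -/

section Primitive

variable {K : Type*} [Field K] [CharZero K] {M : Type*} [AddCommGroup M] [Module K M] {B : BilinForm K M}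
  {h a : Module.End K M}

/-- `φ(p, a^{k+1} w) = 0` for `p` primitive of degree `-k` (`φ(p, a^{k+1} w) = ±φ(a^{k+1} p, w)` and `a^{k+1} p = 0`).
[cite: LooijengaLunts1997, §1 (1.3) p0005 L4–L5] [cite: LooijengaLunts1997, §1 (1.16) p0008 L77–L83] -/
theorem apply_pow_succ_eq_zero_of_mem_primitiveSpace (ha : B.IsSkewAdjoint a) {k : ℕ} {p : M}
    (hp : p ∈ primitiveSpace h a k) (w : M) : B p ((a ^ (k + 1)) w) = 0 := by
  have h1 := apply_pow_pow_eq_of_isSkewAdjoint ha p w (k + 1) 0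
  rw [pow_zero, Module.End.one_apply, add_zero, (mem_primitiveSpace_iff.1 hp).2, map_zero, LinearMap.zero_apply]
    at h1
  -- `0 = (-1)^(k+1) • φ(p, a^{k+1} w)`
  have h2 : ((-1 : K) ^ (k + 1)) ≠ 0 := pow_ne_zero _ (neg_ne_zero.2 one_ne_zero)
  exact (smul_eq_zero.1 h1.symm).resolve_left h2

/-- **Non-degeneracy descends to `P_{-k}` through `β_k(p, q) = φ(p, aᵏq)`**: for `φ` left-separating and invariant
and `0 ≠ p ∈ P_{-k}` there is a primitive `q ∈ P_{-k}` with `φ(p, aᵏq) ≠ 0`.  (Some `φ(p, y) ≠ 0`; by the grading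
`y` may be taken in `M_k = aᵏM_{-k}` (degrees; Lefschetz surjectivity), `y = aᵏ(q + a w)` with `q` primitive (A1-88
`exists_primitive_add`), and `φ(p, a^{k+1} w) = 0`.) [cite: LooijengaLunts1997, §1 (1.16) p0008 L77–L83] [cite: LooijengaLunts1997, §1 (1.15) p0008 L11–L13 ("P(M) := ker f ≅ Hom_𝔤(V(n), M)")] -/
theorem exists_primitive_apply_pow_ne_zero (hgr : IsZGrading h) (La : HasLefschetzProperty h a)
    (hh : B.IsSkewAdjoint h) (ha : B.IsSkewAdjoint a) (hB : B.SeparatingLeft) {k : ℕ} {p : M}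
    (hp : p ∈ primitiveSpace h a k) (hp0 : p ≠ 0) : ∃ q ∈ primitiveSpace h a k, B p ((a ^ k) q) ≠ 0 := by
  have hpdeg := (mem_primitiveSpace_iff.1 hp).1
  -- some homogeneous `y` with `φ(p, y) ≠ 0`
  obtain ⟨l, y, hy, hpy⟩ : ∃ l : ℤ, ∃ y ∈ degreeSpace h l, B p y ≠ 0 := by
    by_contra hno
    push Not at hno
    apply hp0
    refine hB p fun y ↦ ?_
    have hy : y ∈ ⨆ l : ℤ, degreeSpace h l := by rw [hgr]; exact Submodule.mem_top
    induction hy using Submodule.iSup_induction' with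
    | mem l y hy => exact hno l y hy
    | zero => exact map_zero _
    | add y y' _ _ ihy ihy' => rw [map_add, ihy, ihy', add_zero]
  -- `l = k` by the grading
  have hl : l = k := by
    by_contra hl
    exact hpy (apply_eq_zero_of_isSkewAdjoint_of_mem_degreeSpace hh (k := -(k : ℤ)) (l := l) (by omega) hpdeg hy)
  subst hl
  -- `y = aᵏ z`, `z = q + a w`
  obtain ⟨z, hz, rfl⟩ := (La.bijOn k).surjOn hy
  obtain ⟨q, hq, w, hw, rfl⟩ := La.exists_primitive_add hz
  refine ⟨q, hq, fun h0 ↦ hpy ?_⟩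
  rw [map_add, map_add, h0, zero_add, ← Module.End.mul_apply, ← pow_succ]
  exact apply_pow_succ_eq_zero_of_mem_primitiveSpace ha hp w

end Primitive

/-! ### §2 The induced form on `P_{-k}` is alternating when `ε(-1)^k = -1`; even multiplicities -/

section Parity

variable {K : Type*} [Field K] [CharZero K] {M : Type*} [AddCommGroup M] [Module K M] {B : BilinForm K M}
  {h a : Module.End K M}

omit [CharZero K] in
/-- `β_k(q, p) = ε(-1)^k β_k(p, q)` for `φᵀ = εφ`: `φ(q, aᵏp) = εφ(aᵏp, q) = ε(-1)^k φ(p, aᵏq)`.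
[cite: LooijengaLunts1997, §1 (1.16) p0008 L77–L83] -/
theorem primitiveForm_apply_swap (ha : B.IsSkewAdjoint a) {ε : K} (hflip : LinearMap.flip B = ε • B) (k : ℕ)
    (p q : M) : B q ((a ^ k) p) = (ε * (-1) ^ k) * B p ((a ^ k) q) := by
  have h1 : B q ((a ^ k) p) = ε * B ((a ^ k) p) q := by
    have := LinearMap.congr_fun₂ hflip ((a ^ k) p) q
    rw [LinearMap.flip_apply, LinearMap.smul_apply, LinearMap.smul_apply, smul_eq_mul] at this
    exact this
  have h2 := apply_pow_pow_eq_of_isSkewAdjoint ha p q k 0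
  rw [pow_zero, Module.End.one_apply, add_zero, smul_eq_mul] at h2
  rw [h1, h2, mul_assoc]

variable (h a) in
/-- **The induced form `β_k(p, q) = φ(p, aᵏq)` on `P_{-k}` is ALTERNATING when `φᵀ = εφ` with `ε(-1)^k = -1`**
(characteristic `0`). [cite: LooijengaLunts1997, §1 (1.16) p0008 L77–L83] -/
theorem isAlt_primitiveForm (ha : B.IsSkewAdjoint a) {ε : K} (hflip : LinearMap.flip B = ε • B) {k : ℕ}
    (hε : ε * (-1) ^ k = -1) :
    LinearMap.IsAlt (B.compl₁₂ (primitiveSpace h a k).subtype ((a ^ k) ∘ₗ (primitiveSpace h a k).subtype)) := by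
  intro x
  rw [LinearMap.compl₁₂_apply, Submodule.subtype_apply, LinearMap.comp_apply, Submodule.subtype_apply]
  have h1 := primitiveForm_apply_swap ha hflip k (x : M) (x : M)
  rw [hε, neg_one_mul] at h1
  -- `t = -t` in characteristic `0`
  have h2 : (2 : K) * B (x : M) ((a ^ k) (x : M)) = 0 := by linear_combination h1
  simpa using h2

variable (h a) in
/-- **… and NON-DEGENERATE** when `φ` is non-degenerate and invariant (§1). [cite: LooijengaLunts1997, §1 (1.16) p0008 L77–L83] -/
theorem nondegenerate_primitiveForm (hgr : IsZGrading h) (La : HasLefschetzProperty h a) (hh : B.IsSkewAdjoint h)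
    (ha : B.IsSkewAdjoint a) (hB : B.Nondegenerate) {ε : K} (hflip : LinearMap.flip B = ε • B) {k : ℕ}
    (hε : ε * (-1) ^ k = -1) :
    (B.compl₁₂ (primitiveSpace h a k).subtype ((a ^ k) ∘ₗ (primitiveSpace h a k).subtype)).Nondegenerate := by
  have hleft : (B.compl₁₂ (primitiveSpace h a k).subtype ((a ^ k) ∘ₗ (primitiveSpace h a k).subtype)).SeparatingLeft := by
    intro x hx
    by_contra hx0
    have hx0' : (x : M) ≠ 0 := fun h0 ↦ hx0 (Subtype.ext h0)
    obtain ⟨q, hq, hne⟩ := exists_primitive_apply_pow_ne_zero hgr La hh ha hB.1 x.2 hx0'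
    exact hne (hx ⟨q, hq⟩)
  refine ⟨hleft, fun y hy ↦ hleft y fun x ↦ ?_⟩
  -- `β(y, x) = -β(x, y) = 0`
  have h1 := primitiveForm_apply_swap ha hflip k (x : M) (y : M)
  rw [hε, neg_one_mul] at h1
  have h2 := hy x
  rw [LinearMap.compl₁₂_apply, Submodule.subtype_apply, LinearMap.comp_apply, Submodule.subtype_apply] at h2 ⊢
  rw [h1, h2, neg_zero]

variable (h a) in
/-- **Multiplicities are even: `dim P_{-k}` is even when `M` carries a non-degenerate invariant form `φ` with
`φᵀ = εφ` and `ε(-1)^k = -1`** — the induced form on `P_{-k}` is non-degenerate and alternating, and a non-degenerate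
alternating form lives in even dimension (the tree's `even_finrank_of_isAlt_of_nondegenerate`).
[cite: LooijengaLunts1997, §1 (1.16) p0008 L77–L83] -/
theorem even_finrank_primitiveSpace [FiniteDimensional K M] (hgr : IsZGrading h) (La : HasLefschetzProperty h a)
    (hh : B.IsSkewAdjoint h) (ha : B.IsSkewAdjoint a) (hB : B.Nondegenerate) {ε : K}
    (hflip : LinearMap.flip B = ε • B) {k : ℕ} (hε : ε * (-1) ^ k = -1) :
    Even (finrank K (primitiveSpace h a k)) :=
  Literature.GroupTheory.FiniteAbelian.even_finrank_of_isAlt_of_nondegenerate (isAlt_primitiveForm h a ha hflip hε)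
    (nondegenerate_primitiveForm h a hgr La hh ha hB hflip hε)

variable (h a) in
/-- **(1.16), odd case: a non-degenerate invariant SYMMETRIC form forces even multiplicity of `V(k)` for every ODD `k`**
("In the case of odd parity it is just the other way around": an odd-parity representation admits a non-degenerate
invariant symmetric form only if all multiplicities are even). [cite: LooijengaLunts1997, §1 (1.16) p0008 L77–L83] -/
theorem even_finrank_primitiveSpace_of_isSymm [FiniteDimensional K M] (hgr : IsZGrading h)
    (La : HasLefschetzProperty h a) (hh : B.IsSkewAdjoint h) (ha : B.IsSkewAdjoint a) (hB : B.Nondegenerate)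
    (hsymm : B.IsSymm) {k : ℕ} (hk : Odd k) : Even (finrank K (primitiveSpace h a k)) := by
  have hflip : LinearMap.flip B = (1 : K) • B := by
    ext x y
    rw [LinearMap.flip_apply, one_smul]
    exact LinearMap.BilinForm.isSymm_def.1 hsymm y x
  exact even_finrank_primitiveSpace h a hgr La hh ha hB hflip (by rw [hk.neg_one_pow, one_mul])

variable (h a) in
/-- **(1.16), even case: a non-degenerate invariant SKEW-SYMMETRIC form forces even multiplicity of `V(k)` for every
EVEN `k`** ("[an even-parity representation] admits a nondegenerate invariant skew-symmetric form if and only if all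
multiplicities are even" — the "only if"). [cite: LooijengaLunts1997, §1 (1.16) p0008 L77–L83] -/
theorem even_finrank_primitiveSpace_of_flip_eq_neg [FiniteDimensional K M] (hgr : IsZGrading h)
    (La : HasLefschetzProperty h a) (hh : B.IsSkewAdjoint h) (ha : B.IsSkewAdjoint a) (hB : B.Nondegenerate)
    (hskew : LinearMap.flip B = -B) {k : ℕ} (hk : Even k) : Even (finrank K (primitiveSpace h a k)) :=
  even_finrank_primitiveSpace h a hgr La hh ha hB (ε := -1) (by rw [hskew]; exact (neg_one_smul K B).symm)
    (by rw [hk.neg_one_pow, mul_one])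

end Parity

end Literature.Algebra.Lie
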